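import Mathlib
import Literature.NumberTheory.LFunctions.Zhang2022.TypedSection15C
import Literature.NumberTheory.LFunctions.Zhang2022.Section15BCoprimeLocalEstimate
import Literature.NumberTheory.LFunctions.Zhang2022.Section15BLocalEstimates
import Literature.NumberTheory.LFunctions.Zhang2022.AppendixALemma152Closed
import Literature.NumberTheory.LFunctions.Zhang2022.Section15U056Rate
import Literature.NumberTheory.Automorphic.AutomorphicLFunctionSplittingProofs
import HarnessLib

/-!
# Zhang (2022) §15 p.85–86: the local structure of `𝓜₁(d,l;s)/𝓜₁(1,1;s)` — (15.18) off the zero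
# set, `𝓜₁(1,1;1−βⱼ) ≠ 0`, the multiplicativity of `ϖ₁ⱼ`, (15.19), (15.20), §15.u040 and (15.21)

Topic `Literature/NumberTheory/LFunctions/Zhang2022` (Landau–Siegel audit tree; verdict-neutral).
Y. Zhang, *Discrete mean estimates and the Landau–Siegel zero*, arXiv:2211.02515v1 (2022)
[Zhang2022LandauSiegel] — **an unrefereed manuscript under adjudication; nothing here asserts or denies
its Theorems 1–2.** ZHANG-L discharge lane (WP15), helper file for the leaves `Typed.Section15C.Step15_u050`
(and `Lemma153RpI`): every input is a tree theorem; no new definition, no named fact.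

## Content

* `calM1_div_eq_prod_factor_div`, `calM1_div_eq_prod_localRatio` — **(15.18) whenever `𝓜₁(1,1;s) ≠ 0`**:
  `𝓜₁ = Typed.Section15B.calM1` is DEFINED as the Euler product `∏'_q calM1Factor(q;d,l;s)`; its factors
  depend on `(d,l)` only through `q ∣ d`, `q ∣ l` (tree `lamTilde1_prime_mul_eq`, `xi1LocalSeries_mul_eq`),
  so — splitting the unconditional product at the finite set of primes dividing `dl`
  (`Literature.NumberTheory.Automorphic.prod_mul_tprod_compl_of_multipliable`) — the quotient is the
  finite product over `q ∣ dl` of the local quotients. The typed node `Typed.Section15B.Eq15_18` states the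
  same with the printed division and therefore also asserts `𝓜₁(1,1;s) ≠ 0` on the whole half-plane
  `σ > 9/10` (`calM1_one_one_ne_zero_of_eq15_18`); that non-vanishing is NOT claimed here — only the
  instance the §15 chain uses:
* `calM1_one_one_betaJ_ne_zero` — **`‖𝓜₁(1,1;1−βⱼ)‖ ≥ 1/2`** for all large `D` under (A), `1 ≤ j ≤ 3`, from
  Lemma 15.2 (tree `AppendixALocal.lemma152I_holds`: `𝓜₁(1,1;s) = ∏_{(q,D)=1}(1−χ(q)q⁻²)/(1−q⁻²) + O(α𝓛)`,
  `|s−1| < 5α`) and `‖∏_{(q,D)=1}(1−χ(q)q⁻²)/(1−q⁻²)‖ ≥ 1` (`one_le_norm_eulerM1`).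
* `inline15_varpiMult_holds`, `eq15_19_lit_holds`/`eq15_19_chi_holds`, `eq15_20_lit_holds`/`eq15_20_chi_holds`
  — the inline claim "`ϖ₁ⱼ` is multiplicative" (p.85, tex L4246), (15.19) and (15.20) DISCHARGED for every
  `c′` (the tree edges `…_of_eq15_18` re-run on the restricted (15.18)).
* `step15_u040_holds`, `eq15_21_holds` — **§15.u040 and (15.21) DISCHARGED**: for `n = dl < PT⁻³`,
  `(n,𝒬) = 1`, `λ₁(d)𝓜₁(d,l;1−βⱼ)/𝓜₁(1,1;1−βⱼ) = ∏_{q∣n}(local quotient·λ-factor) = 1 + O(D⁻²)`, each local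
  factor being `1 + O(q^{−9/10})` by §15.u032/u033 (tree `step15_u032_holds`, `step15_u033_holds`) and
  `λ₁(q) = 1 + O(1/q)` (`norm_lam1_prime_one_sub_one_le`), with every `q ∣ n` at least `D⁴`.

## References

* Y. Zhang, arXiv:2211.02515v1 (2022), §15 pp. 84–86, (15.18)–(15.21); Lemma 15.2 p. 87.
  [cite: Zhang2022LandauSiegel, §15 pp.84–87]
-/

noncomputable section

open Complex Real Filter
open _root_.Topology
open Literature.NumberTheory.LFunctions.Zhang2022.Skeleton
open Literature.NumberTheory.LFunctions.Zhang2022.Typed.Section15A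

namespace Literature.NumberTheory.LFunctions.Zhang2022.Typed.Section15B

/-! ## §1. Locality of the Euler factors and the splitting of `∏'_q` at the primes dividing `dl` -/

/-- For a prime `q ∤ dl` the Euler factor of `𝓜₁(d,l;s)` at `q` is the Euler factor of `𝓜₁(1,1;s)`
(p.85, tex L4232: "If `(q,dl) = 1`, then `λ̃₁(q,d) = λ̃₁(q,1)` and `ξ₁(qʳ;d,l) = ξ₁(qʳ;1,1)`").
[cite: Zhang2022LandauSiegel, §15 p.85] -/
theorem calM1Factor_eq_one_one_of_not_dvd (c' : ℝ) {D : ℕ} (χ : DirichletCharacter ℂ D)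
    {q d l : ℕ} (hq : q.Prime) (hndvd : ¬ q ∣ d * l) (s : ℂ) :
    calM1Factor c' χ q d l s = calM1Factor c' χ q 1 1 s := by
  have hcop : Nat.Coprime q (d * l) := (Nat.Prime.coprime_iff_not_dvd hq).mpr hndvd
  have hd' : Nat.Coprime q d := Nat.Coprime.coprime_mul_right_right hcop
  have hl' : Nat.Coprime q l := Nat.Coprime.coprime_mul_left_right hcop
  have h1 := lamTilde1_prime_mul_eq c' χ hq 1 hd'
  have h2 := xi1LocalSeries_mul_eq c' χ hq 1 1 hd' hl' s
  rw [one_mul] at h1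
  rw [one_mul, one_mul] at h2
  unfold calM1Factor
  rw [h1, h2]

/-- If `𝓜₁(1,1;s) = ∏'_q calM1Factor(q;1,1;s)` is non-zero, then no Euler factor vanishes
(`tprod_of_exists_eq_zero`). [cite: Zhang2022LandauSiegel, §15 (15.18) p.85] -/
theorem calM1Factor_one_one_ne_zero_of_calM1_ne_zero (c' : ℝ) {D : ℕ} (χ : DirichletCharacter ℂ D)
    {s : ℂ} (hne : calM1 c' χ 1 1 s ≠ 0) {q : ℕ} (hq : q.Prime) :
    calM1Factor c' χ q 1 1 s ≠ 0 := by
  intro h0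
  apply hne
  unfold calM1
  exact tprod_of_exists_eq_zero ⟨⟨q, hq⟩, h0⟩

/-- **(15.18), factor form, off the zero set**: if the Euler product of `𝓜₁(1,1;s)` converges and
`𝓜₁(1,1;s) ≠ 0`, then `𝓜₁(d,l;s)/𝓜₁(1,1;s) = ∏_{q∣dl} calM1Factor(q;d,l;s)/calM1Factor(q;1,1;s)`
(the factors at `q ∤ dl` coincide and their product is a common non-zero number).
[cite: Zhang2022LandauSiegel, §15 (15.18) p.85] -/
theorem calM1_div_eq_prod_factor_div (c' : ℝ) {D : ℕ} (χ : DirichletCharacter ℂ D) {d l : ℕ}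
    (hd : 1 ≤ d) (hl : 1 ≤ l) (s : ℂ)
    (hmul : Multipliable fun q : Nat.Primes => calM1Factor c' χ (q : ℕ) 1 1 s)
    (hne : calM1 c' χ 1 1 s ≠ 0) :
    calM1 c' χ d l s / calM1 c' χ 1 1 s =
      ∏ q ∈ (d * l).primeFactors, calM1Factor c' χ q d l s / calM1Factor c' χ q 1 1 s := by
  classical
  -- work at the type `Subtype Nat.Prime` (= `Nat.Primes` by definition)
  set F : Subtype Nat.Prime → ℂ := fun q => calM1Factor c' χ (q : ℕ) d l s with hF
  set F₀ : Subtype Nat.Prime → ℂ := fun q => calM1Factor c' χ (q : ℕ) 1 1 s with hF₀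
  have hmul₀ : Multipliable F₀ := hmul
  set S : Finset (Subtype Nat.Prime) := (d * l).primeFactors.subtype Nat.Prime with hS
  have hdl : d * l ≠ 0 := Nat.mul_ne_zero (by omega) (by omega)
  have hmemS : ∀ q : Subtype Nat.Prime, q ∈ S ↔ (q : ℕ) ∣ d * l := by
    intro q
    rw [hS, Finset.mem_subtype, Nat.mem_primeFactors]
    exact ⟨fun h => h.2.1, fun h => ⟨q.prop, h, hdl⟩⟩
  have hFF₀ : ∀ q : Subtype Nat.Prime, q ∉ S → F q = F₀ q := fun q hq =>
    calM1Factor_eq_one_one_of_not_dvd c' χ q.prop ((hmemS q).not.mp hq) s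
  have hM₀ : calM1 c' χ 1 1 s = ∏' q, F₀ q := rfl
  have hM : calM1 c' χ d l s = ∏' q, F q := rfl
  -- no factor of `F₀` vanishes
  have hF₀ne : ∀ q, F₀ q ≠ 0 := fun q =>
    calM1Factor_one_one_ne_zero_of_calM1_ne_zero c' χ hne q.prop
  have hPS : ∏ q ∈ S, F₀ q ≠ 0 := Finset.prod_ne_zero_iff.mpr fun q _ => hF₀ne q
  -- multipliability off `S`
  have hc₀ : Multipliable (F₀ ∘ (↑) : ↥((↑S : Set (Subtype Nat.Prime))ᶜ) → ℂ) :=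
    Literature.NumberTheory.Automorphic.multipliable_compl_of_isUnit_prod S hmul₀ (Ne.isUnit hPS)
  have hcompl : ∀ q : ↥((↑S : Set (Subtype Nat.Prime))ᶜ),
      F (q : Subtype Nat.Prime) = F₀ (q : Subtype Nat.Prime) := by
    intro q
    refine hFF₀ q ?_
    have hq := q.prop
    rwa [Set.mem_compl_iff, Finset.mem_coe] at hq
  have hc : Multipliable (F ∘ (↑) : ↥((↑S : Set (Subtype Nat.Prime))ᶜ) → ℂ) := by
    refine hc₀.congr fun q => ?_
    simp only [Function.comp_apply]
    exact (hcompl q).symm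
  have hsplit₀ := Literature.NumberTheory.Automorphic.prod_mul_tprod_compl_of_multipliable S hc₀
  have hsplit := Literature.NumberTheory.Automorphic.prod_mul_tprod_compl_of_multipliable S hc
  have hR : ∏' q : ↥((↑S : Set (Subtype Nat.Prime))ᶜ), F q =
      ∏' q : ↥((↑S : Set (Subtype Nat.Prime))ᶜ), F₀ q :=
    tprod_congr fun q => hcompl q
  have hRne : ∏' q : ↥((↑S : Set (Subtype Nat.Prime))ᶜ), F₀ q ≠ 0 := by
    intro h0
    apply hne
    rw [hM₀, ← hsplit₀, h0, mul_zero]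
  rw [hM, hM₀, ← hsplit, ← hsplit₀, hR, mul_div_mul_right _ _ hRne, ← Finset.prod_div_distrib]
  -- rewrite the product over `S` as a product over `(dl).primeFactors ⊆ ℕ`
  rw [hS]
  show ∏ x ∈ (d * l).primeFactors.subtype Nat.Prime,
      (fun n : ℕ => calM1Factor c' χ n d l s / calM1Factor c' χ n 1 1 s) (x : ℕ) = _
  exact Finset.prod_subtype_of_mem
    (fun n : ℕ => calM1Factor c' χ n d l s / calM1Factor c' χ n 1 1 s)
    fun q hq => Nat.prime_of_mem_primeFactors hq

/-- **(15.18) off the zero set** (p.85, tex L4235): if the Euler product of `𝓜₁(1,1;s)` converges and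
`𝓜₁(1,1;s) ≠ 0`, then `𝓜₁(d,l;s)/𝓜₁(1,1;s) = ∏_{q∣dl}(1 + λ̃₁(q,d)Σ_rξ₁(qʳ;d,l)q^{−rs})
(1 + λ̃₁(q,1)Σ_rξ₁(qʳ;1,1)q^{−rs})⁻¹` (the common prefactor
`(1−q^{−s−β₁})(1−q^{−s−β₂})/((1−q^{−s})(1−χ(q)q^{−s}))` of the two Euler factors cancels; it is non-zero
because the factor of `𝓜₁(1,1;s)` is). [cite: Zhang2022LandauSiegel, §15 (15.18) p.85] -/
theorem calM1_div_eq_prod_localRatio (c' : ℝ) {D : ℕ} (χ : DirichletCharacter ℂ D) {d l : ℕ}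
    (hd : 1 ≤ d) (hl : 1 ≤ l) (s : ℂ)
    (hmul : Multipliable fun q : Nat.Primes => calM1Factor c' χ (q : ℕ) 1 1 s)
    (hne : calM1 c' χ 1 1 s ≠ 0) :
    calM1 c' χ d l s / calM1 c' χ 1 1 s =
      ∏ q ∈ (d * l).primeFactors,
        (1 + lamTilde1 c' χ q d * xi1LocalSeries c' χ q d l s) *
          (1 + lamTilde1 c' χ q 1 * xi1LocalSeries c' χ q 1 1 s)⁻¹ := by
  rw [calM1_div_eq_prod_factor_div c' χ hd hl s hmul hne]
  refine Finset.prod_congr rfl fun q hq => ?_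
  have hqP := Nat.prime_of_mem_primeFactors hq
  have hF₀ne := calM1Factor_one_one_ne_zero_of_calM1_ne_zero c' χ hne hqP
  unfold calM1Factor at hF₀ne ⊢
  set R : ℂ := (1 - (q : ℂ) ^ (-(s + Skeleton.beta1 c' D))) *
      (1 - (q : ℂ) ^ (-(s + Skeleton.beta2 c' D))) /
    ((1 - (q : ℂ) ^ (-s)) * (1 - χ (q : ZMod D) * (q : ℂ) ^ (-s))) with hR
  have hRne : R ≠ 0 := by
    intro h0
    apply hF₀ne
    rw [h0, zero_mul]
  rw [mul_div_mul_left _ _ hRne, div_eq_mul_inv]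

/-- **(15.18) off the zero set, eventual form** — for all large `D`, under (A): for `d, l ≥ 1` and
`σ > 9/10`, IF `𝓜₁(1,1;s) ≠ 0` then the display (15.18) holds (multipliability of the Euler product
from §15.u034, tree `step15_u034an_holds`). [cite: Zhang2022LandauSiegel, §15 (15.18) p.85] -/
theorem eq15_18_of_ne_zero (c' : ℝ) :
    ForAllLarge fun D _ χ => AssumptionA D χ → ∀ d l : ℕ, 1 ≤ d → 1 ≤ l → ∀ s : ℂ, 9 / 10 < s.re →
      calM1 c' χ 1 1 s ≠ 0 →
        calM1 c' χ d l s / calM1 c' χ 1 1 s =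
          ∏ q ∈ (d * l).primeFactors,
            (1 + lamTilde1 c' χ q d * xi1LocalSeries c' χ q d l s) *
              (1 + lamTilde1 c' χ q 1 * xi1LocalSeries c' χ q 1 1 s)⁻¹ := by
  refine (step15_u034an_holds c').mono fun D _ χ _ _ h hA d l hd hl s hs hne => ?_
  exact calM1_div_eq_prod_localRatio c' χ hd hl s ((h hA 1 1 le_rfl le_rfl).1 s hs) hne

/-- The factor form of the same eventual statement:
`𝓜₁(d,l;s)/𝓜₁(1,1;s) = ∏_{q∣dl} calM1Factor(q;d,l;s)/calM1Factor(q;1,1;s)` whenever `𝓜₁(1,1;s) ≠ 0`.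
[cite: Zhang2022LandauSiegel, §15 (15.18) p.85] -/
theorem calM1_div_eq_prod_factor_div_eventually (c' : ℝ) :
    ForAllLarge fun D _ χ => AssumptionA D χ → ∀ d l : ℕ, 1 ≤ d → 1 ≤ l → ∀ s : ℂ, 9 / 10 < s.re →
      calM1 c' χ 1 1 s ≠ 0 →
        calM1 c' χ d l s / calM1 c' χ 1 1 s =
          ∏ q ∈ (d * l).primeFactors, calM1Factor c' χ q d l s / calM1Factor c' χ q 1 1 s := by
  refine (step15_u034an_holds c').mono fun D _ χ _ _ h hA d l hd hl s hs hne => ?_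
  exact calM1_div_eq_prod_factor_div c' χ hd hl s ((h hA 1 1 le_rfl le_rfl).1 s hs) hne

/-! ## §2. `𝓜₁(1,1;1−βⱼ) ≠ 0` from Lemma 15.2 -/

/-- Every factor of the Euler product `∏_{(q,D)=1}(1 − χ(q)q⁻²)/(1 − q⁻²)` of Lemma 15.2 has modulus
`≥ 1` (`|χ(q)| ≤ 1`, `q ≥ 2`). [cite: Zhang2022LandauSiegel, §15 Lemma 15.2 p.87] -/
theorem one_le_norm_eulerM1_factor {D : ℕ} (χ : DirichletCharacter ℂ D) (p : Nat.Primes) :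
    1 ≤ ‖(if Nat.Coprime (p : ℕ) D then
        (1 - χ ((p : ℕ) : ZMod D) / ((p : ℕ) : ℂ) ^ 2) / (1 - 1 / ((p : ℕ) : ℂ) ^ 2) else (1 : ℂ))‖ := by
  split_ifs with h
  · have hp2 : (2 : ℝ) ≤ ((p : ℕ) : ℝ) := by exact_mod_cast p.prop.two_le
    have hp0 : (0 : ℝ) < ((p : ℕ) : ℝ) := by linarith
    have hx : ‖(1 : ℂ) / ((p : ℕ) : ℂ) ^ 2‖ = 1 / ((p : ℕ) : ℝ) ^ 2 := by
      rw [norm_div, norm_one, norm_pow, Complex.norm_natCast]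
    have hlt : 1 / ((p : ℕ) : ℝ) ^ 2 < 1 := by
      rw [div_lt_one (by positivity)]; nlinarith
    have hden : ‖(1 : ℂ) - 1 / ((p : ℕ) : ℂ) ^ 2‖ = 1 - 1 / ((p : ℕ) : ℝ) ^ 2 := by
      have : (1 : ℂ) - 1 / ((p : ℕ) : ℂ) ^ 2 = ((1 - 1 / ((p : ℕ) : ℝ) ^ 2 : ℝ) : ℂ) := by
        push_cast; ring
      rw [this, Complex.norm_real, Real.norm_eq_abs, abs_of_pos (by linarith)]
    have hnum : 1 - 1 / ((p : ℕ) : ℝ) ^ 2 ≤ ‖(1 : ℂ) - χ ((p : ℕ) : ZMod D) / ((p : ℕ) : ℂ) ^ 2‖ := by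
      have h1 : ‖χ ((p : ℕ) : ZMod D) / ((p : ℕ) : ℂ) ^ 2‖ ≤ 1 / ((p : ℕ) : ℝ) ^ 2 := by
        rw [norm_div, norm_pow, Complex.norm_natCast]
        gcongr
        exact χ.norm_le_one _
      have h2 := norm_sub_norm_le (1 : ℂ) (χ ((p : ℕ) : ZMod D) / ((p : ℕ) : ℂ) ^ 2)
      rw [norm_one] at h2
      linarith
    rw [norm_div, hden, le_div_iff₀ (by linarith), one_mul]
    exact hnum
  · simp

/-- **`‖∏_{(q,D)=1}(1 − χ(q)q⁻²)/(1 − q⁻²)‖ ≥ 1`**: the Euler product `eulerM1` of Lemma 15.2 converges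
(tree `Ded1524.multipliable_eulerM1_eulerU1`) and every partial product has modulus `≥ 1`.
[cite: Zhang2022LandauSiegel, §15 Lemma 15.2 p.87] -/
theorem one_le_norm_eulerM1 {D : ℕ} (χ : DirichletCharacter ℂ D) : 1 ≤ ‖Section15C.eulerM1 χ‖ := by
  obtain ⟨hM, -⟩ := Zhang2022.Ded1524.multipliable_eulerM1_eulerU1 χ
  have h := hM.hasProd.norm
  rw [HasProd, SummationFilter.unconditional_filter] at h
  rw [Section15C.eulerM1]
  refine ge_of_tendsto' h fun s => ?_
  exact Finset.prod_induction _ (fun x : ℝ => 1 ≤ x)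
    (fun a b ha hb => one_le_mul_of_one_le_of_one_le ha hb) le_rfl
    (fun p _ => one_le_norm_eulerM1_factor χ p)

/-- `⌈exp M⌉ ≤ D ⇒ M ≤ 𝓛 = log D`. [folklore] -/
private theorem le_ell_of_ceil_exp_le {M : ℝ} {D : ℕ} (hD : ⌈Real.exp M⌉₊ ≤ D) : M ≤ ell D := by
  have h : Real.exp M ≤ D := le_trans (Nat.le_ceil _) (by exact_mod_cast hD)
  exact (Real.le_log_iff_exp_le (lt_of_lt_of_le (Real.exp_pos _) h)).mpr h

/-- Eventually `M ≤ 𝓛`. [folklore] -/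
private theorem forAllLarge_le_ell (M : ℝ) : ForAllLarge fun D _ _ => M ≤ ell D :=
  ForAllLarge.of_le ⌈Real.exp M⌉₊ fun _ _ _ hD _ _ => le_ell_of_ceil_exp_le hD

/-- The standing size facts at a large modulus: for `𝓛 ≥ max(3, 14|c′|π + 1)` one has `D ≥ 3`,
`α = π/𝓛⁹ > 0`, `α𝓛 = π/𝓛⁸ ≤ π/𝓛`, and `|c′α𝓛| ≤ 1/14`. [cite: Zhang2022LandauSiegel, §2 (2.10), (2.13)] -/
theorem sizes_of_ell_ge (c' : ℝ) {D : ℕ} [NeZero D] (hℓ3 : 3 ≤ ell D)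
    (hℓc : 14 * |c'| * π + 1 ≤ ell D) :
    3 ≤ D ∧ 0 < alpha D ∧ alpha D * ell D = π / ell D ^ 8 ∧ alpha D * ell D ≤ π / ell D ∧
      |c' * alpha D * ell D| ≤ 1 / 14 := by
  have hℓ1 : 1 ≤ ell D := by linarith
  have hℓ0 : 0 < ell D := by linarith
  have hD3 : 3 ≤ D := by
    by_contra hlt
    have h3 : (D : ℝ) < 3 := by exact_mod_cast not_le.mp hlt
    have hD0 : 0 < (D : ℝ) := by exact_mod_cast Nat.pos_of_ne_zero (NeZero.ne D)
    have : ell D < 3 := by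
      calc ell D = Real.log D := rfl
        _ < Real.log (Real.exp 3) := Real.log_lt_log hD0 (by
            have := Real.add_one_le_exp (3:ℝ); linarith)
        _ = 3 := Real.log_exp 3
    linarith
  have hα : alpha D = π / ell D ^ 9 := by rw [alpha, bigP, Real.log_exp]
  have hαpos : 0 < alpha D := by rw [hα]; positivity
  have hα1 : alpha D * ell D = π / ell D ^ 8 := by rw [hα]; field_simp
  have hαℓ : alpha D * ell D ≤ π / ell D := by
    rw [hα1]
    apply div_le_div_of_nonneg_left Real.pi_pos.le hℓ0
    calc ell D = ell D ^ 1 := (pow_one _).symm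
      _ ≤ ell D ^ 8 := pow_le_pow_right₀ hℓ1 (by norm_num)
  have hθ : |c' * alpha D * ell D| ≤ 1 / 14 := by
    rw [abs_mul, abs_mul, abs_of_pos hαpos, abs_of_pos hℓ0, mul_assoc, hα1,
      show |c'| * (π / ell D ^ 8) = |c'| * π / ell D ^ 8 by ring,
      div_le_div_iff₀ (by positivity) (by norm_num)]
    have h8 : ell D ≤ ell D ^ 8 := by
      calc ell D = ell D ^ 1 := (pow_one _).symm
        _ ≤ ell D ^ 8 := pow_le_pow_right₀ hℓ1 (by norm_num)
    nlinarith [abs_nonneg c', Real.pi_pos]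
  exact ⟨hD3, hαpos, hα1, hαℓ, hθ⟩

/-- **`𝓜₁(1,1;1−βⱼ) ≠ 0`, quantitatively** — for all large `D`, under (A), for `j ∈ {1,2,3}`:
`‖βⱼ‖ < 5α`, `Re(1−βⱼ) = 1`, and `‖𝓜₁(1,1;1−βⱼ)‖ ≥ 1/2` (Lemma 15.2, tree `AppendixALocal.lemma152I_holds`,
gives `𝓜₁(1,1;1−βⱼ) = eulerM1 + O(α𝓛)` with `‖eulerM1‖ ≥ 1` and `α𝓛 = π/𝓛⁸ → 0`).
[cite: Zhang2022LandauSiegel, §15 Lemma 15.2 p.87] -/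
theorem norm_calM1_one_one_betaJ_ge (c' : ℝ) :
    ForAllLarge fun D _ χ => AssumptionA D χ → ∀ j ∈ ({1, 2, 3} : Finset ℕ),
      ‖betaJ c' D j‖ < 5 * alpha D ∧ (1 - betaJ c' D j).re = 1 ∧
        1 / 2 ≤ ‖calM1 c' χ 1 1 (1 - betaJ c' D j)‖ := by
  obtain ⟨C₁, h152⟩ := (AppendixALocal.lemma152I_holds c' :
    Section15C.Lemma152 c' Section15C.inputs15AB)
  set M : ℝ := max 3 (max (14 * |c'| * π + 1) (2 * |C₁| * π)) with hM
  refine (h152.and (forAllLarge_le_ell M)).mono fun D _ χ _ _ h hA j hj => ?_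
  obtain ⟨g152, hMℓ⟩ := h
  have hℓ3 : 3 ≤ ell D := (le_max_left _ _).trans hMℓ
  have hℓc : 14 * |c'| * π + 1 ≤ ell D := ((le_max_left _ _).trans (le_max_right _ _)).trans hMℓ
  have hℓC : 2 * |C₁| * π ≤ ell D := ((le_max_right _ _).trans (le_max_right _ _)).trans hMℓ
  have hℓ0 : 0 < ell D := by linarith
  obtain ⟨-, hαpos, hα1, hαℓ, hθ⟩ := sizes_of_ell_ge c' hℓ3 hℓc
  obtain ⟨hβ5, hβre⟩ := Zhang2022.Ded1524.betaJ_norm_lt c' hαpos hθ hj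
  set s : ℂ := 1 - betaJ c' D j with hs
  have hs1 : ‖s - 1‖ < 5 * alpha D := by rw [hs, sub_sub_cancel_left, norm_neg]; exact hβ5
  have hsre : s.re = 1 := by rw [hs, Complex.sub_re, Complex.one_re, hβre]; norm_num
  refine ⟨hβ5, hsre, ?_⟩
  have e152 : ‖calM1 c' χ 1 1 s - Section15C.eulerM1 χ‖ ≤ C₁ * (alpha D * ell D) := by
    have h := g152 hA s hs1
    rw [Section15C.Step15_u051, Section15C.inputs15AB_calM1] at h
    exact h
  have hsmall : C₁ * (alpha D * ell D) ≤ 1 / 2 := by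
    calc C₁ * (alpha D * ell D) ≤ |C₁| * (alpha D * ell D) := by
          gcongr; exact le_abs_self C₁
      _ ≤ |C₁| * (π / ell D) := by gcongr
      _ = |C₁| * π / ell D := by ring
      _ ≤ 1 / 2 := by
          rw [div_le_iff₀ hℓ0]
          nlinarith [abs_nonneg C₁, Real.pi_pos]
  have h1 := one_le_norm_eulerM1 χ
  have h2 := norm_sub_norm_le (Section15C.eulerM1 χ) (calM1 c' χ 1 1 s)
  rw [norm_sub_rev] at h2
  linarith

/-- **`𝓜₁(1,1;1−βⱼ) ≠ 0`** for all large `D`, under (A), `j ∈ {1,2,3}`.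
[cite: Zhang2022LandauSiegel, §15 Lemma 15.2 p.87] -/
theorem calM1_one_one_betaJ_ne_zero (c' : ℝ) :
    ForAllLarge fun D _ χ => AssumptionA D χ → ∀ j ∈ ({1, 2, 3} : Finset ℕ),
      calM1 c' χ 1 1 (1 - betaJ c' D j) ≠ 0 := by
  refine (norm_calM1_one_one_betaJ_ge c').mono fun D _ χ _ _ h hA j hj h0 => ?_
  have h1 := (h hA j hj).2.2
  rw [h0, norm_zero] at h1
  linarith

/-! ## §3. "`ϖ₁ⱼ` is multiplicative" (p.85), (15.19) and (15.20), discharged -/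

/-- The divisor pairs of `mn`, `(m,n) = 1`, are the products of the divisor pairs of `m` and of `n`
(the bijection `((i,j),(k,l)) ↦ (ik, jl)`; proved privately in `TypedSection15B`/`TypedSection16B` for
the same purpose — re-proved here privately to keep those files untouched). [folklore] -/
private theorem sum_divisorsAntidiagonal_mul_of_coprime {M : Type*} [AddCommMonoid M] {m n : ℕ}
    (hmn : m.Coprime n) (f : ℕ × ℕ → M) :
    ∑ w ∈ (m * n).divisorsAntidiagonal, f w =
      ∑ x ∈ m.divisorsAntidiagonal, ∑ y ∈ n.divisorsAntidiagonal, f (x.1 * y.1, x.2 * y.2) := by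
  rw [← Finset.sum_product']
  symm
  apply Finset.sum_nbij fun ((i, j), k, l) ↦ (i * k, j * l)
  · rintro ⟨⟨a1, a2⟩, ⟨b1, b2⟩⟩ h
    simp only [Nat.mem_divisorsAntidiagonal, Ne, Finset.mem_product] at h
    rcases h with ⟨⟨rfl, ha⟩, ⟨rfl, hb⟩⟩
    simp only [Nat.mem_divisorsAntidiagonal, mul_eq_zero, Ne]
    constructor
    · ring
    rw [mul_eq_zero] at *
    exact not_or_intro ha hb
  · simp only [Set.InjOn, Finset.mem_coe, Nat.mem_divisorsAntidiagonal, Finset.mem_product, Prod.mk_inj]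
    rintro ⟨⟨a1, a2⟩, ⟨b1, b2⟩⟩ ⟨⟨rfl, ha⟩, ⟨rfl, hb⟩⟩ ⟨⟨c1, c2⟩, ⟨d1, d2⟩⟩ hcd h
    have cop := hmn
    ext
    · trans Nat.gcd (a1 * a2) (a1 * b1)
      · rw [Nat.gcd_mul_left, cop.coprime_mul_left.coprime_mul_right_right.gcd_eq_one, mul_one]
      · rw [← hcd.1.1, ← hcd.2.1] at cop
        rw [← hcd.1.1, h.1, Nat.gcd_mul_left,
          cop.coprime_mul_left.coprime_mul_right_right.gcd_eq_one, mul_one]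
    · trans Nat.gcd (a1 * a2) (a2 * b2)
      · rw [mul_comm, Nat.gcd_mul_left, cop.coprime_mul_right.coprime_mul_left_right.gcd_eq_one,
          mul_one]
      · rw [← hcd.1.1, ← hcd.2.1] at cop
        rw [← hcd.1.1, h.2, mul_comm, Nat.gcd_mul_left,
          cop.coprime_mul_right.coprime_mul_left_right.gcd_eq_one, mul_one]
    · trans Nat.gcd (b1 * b2) (a1 * b1)
      · rw [mul_comm, Nat.gcd_mul_right,
          cop.coprime_mul_right.coprime_mul_left_right.symm.gcd_eq_one, one_mul]
      · rw [← hcd.1.1, ← hcd.2.1] at cop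
        rw [← hcd.2.1, h.1, mul_comm c1 d1, Nat.gcd_mul_left,
          cop.coprime_mul_right.coprime_mul_left_right.symm.gcd_eq_one, mul_one]
    · trans Nat.gcd (b1 * b2) (a2 * b2)
      · rw [Nat.gcd_mul_right, cop.coprime_mul_left.coprime_mul_right_right.symm.gcd_eq_one, one_mul]
      · rw [← hcd.1.1, ← hcd.2.1] at cop
        rw [← hcd.2.1, h.2, Nat.gcd_mul_right,
          cop.coprime_mul_left.coprime_mul_right_right.symm.gcd_eq_one, one_mul]
  · simp only [Set.SurjOn, Set.subset_def, Finset.mem_coe, Nat.mem_divisorsAntidiagonal,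
      Finset.mem_product, Set.mem_image]
    rintro ⟨b1, b2⟩ h
    use ((b1.gcd m, b2.gcd m), (b1.gcd n, b2.gcd n))
    rw [← hmn.gcd_mul _, ← hmn.gcd_mul _, ← h.1, Nat.gcd_mul_gcd_of_coprime_of_mul_eq_mul hmn h.1,
      Nat.gcd_mul_gcd_of_coprime_of_mul_eq_mul hmn.symm _]
    · rw [Ne, mul_eq_zero, not_or] at h
      simp [h.2.1, h.2.2]
    rw [mul_comm n m, h.1]
  · rintro ⟨⟨a1, a2⟩, ⟨b1, b2⟩⟩ _
    rfl

/-- **"In view of (15.18), we see that `ϖ₁ⱼ(n)` is a multiplicative function" (p.85, tex L4246) —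
DISCHARGED** for every `c′`: `Inline15_varpiMult c′`. The tree edge `inline15_varpiMult_of_eq15_18`
re-run with (15.18) restricted to `s = 1 − βⱼ`, where `𝓜₁(1,1;1−βⱼ) ≠ 0` (`calM1_one_one_betaJ_ne_zero`)
makes the restricted display available (`eq15_18_of_ne_zero`): the summand of
`ϖ₁ⱼ(n) = Σ_{n=dl} λ₁(d)d^{βⱼ}χ(l)𝓜₁(d,l;1−βⱼ)/𝓜₁(1,1;1−βⱼ)` is multiplicative in the pair `(d,l)` over
coprime supports (`prod_localRatio_mul`, `lam1_mul_of_coprime`), and `ϖ₁ⱼ(1) = 1`.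
[cite: Zhang2022LandauSiegel, §15 p.85] -/
theorem inline15_varpiMult_holds (c' : ℝ) : Inline15_varpiMult c' := by
  refine ((eq15_18_of_ne_zero c').and (norm_calM1_one_one_betaJ_ge c')).mono
    fun D _ χ _ _ h hA j hj => ?_
  obtain ⟨h18D, hneD⟩ := h
  obtain ⟨-, hsre1, hnorm⟩ := hneD hA j hj
  have hsre : 9 / 10 < (1 - Skeleton.betaJ c' D j).re := by rw [hsre1]; norm_num
  have hM0 : calM1 c' χ 1 1 (1 - Skeleton.betaJ c' D j) ≠ 0 := by
    intro h0; rw [h0, norm_zero] at hnorm; linarith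
  have hrat := fun d l (hd : 1 ≤ d) (hl : 1 ≤ l) => h18D hA d l hd hl _ hsre hM0
  constructor
  · unfold varpi1
    rw [Nat.divisorsAntidiagonal_one, Finset.sum_singleton, div_self hM0]
    unfold lam1
    simp
  · intro m n hmn
    rcases Nat.eq_zero_or_pos m with hm0 | hm0
    · subst hm0
      simp [varpi1]
    rcases Nat.eq_zero_or_pos n with hn0 | hn0
    · subst hn0
      simp [varpi1]
    unfold varpi1
    rw [sum_divisorsAntidiagonal_mul_of_coprime hmn, Finset.sum_mul_sum]
    refine Finset.sum_congr rfl fun x hx => Finset.sum_congr rfl fun y hy => ?_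
    have hx' := Nat.mem_divisorsAntidiagonal.mp hx
    have hy' := Nat.mem_divisorsAntidiagonal.mp hy
    have hx1 : 1 ≤ x.1 := Nat.pos_of_ne_zero fun h0 => hx'.2 (by rw [← hx'.1, h0, zero_mul])
    have hx2 : 1 ≤ x.2 := Nat.pos_of_ne_zero fun h0 => hx'.2 (by rw [← hx'.1, h0, mul_zero])
    have hy1 : 1 ≤ y.1 := Nat.pos_of_ne_zero fun h0 => hy'.2 (by rw [← hy'.1, h0, zero_mul])
    have hy2 : 1 ≤ y.2 := Nat.pos_of_ne_zero fun h0 => hy'.2 (by rw [← hy'.1, h0, mul_zero])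
    have hcop : Nat.Coprime (x.1 * x.2) (y.1 * y.2) := by rw [hx'.1, hy'.1]; exact hmn
    have hcop1 : Nat.Coprime x.1 y.1 :=
      Nat.Coprime.coprime_dvd_left (Dvd.intro _ rfl)
        (Nat.Coprime.coprime_dvd_right (Dvd.intro _ rfl) hcop)
    simp only
    rw [div_eq_mul_inv, div_eq_mul_inv, div_eq_mul_inv]
    rw [← div_eq_mul_inv (calM1 c' χ (x.1 * y.1) (x.2 * y.2) _),
      ← div_eq_mul_inv (calM1 c' χ x.1 x.2 _), ← div_eq_mul_inv (calM1 c' χ y.1 y.2 _),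
      hrat _ _ (Nat.one_le_iff_ne_zero.mpr (Nat.mul_ne_zero (by omega) (by omega)))
        (Nat.one_le_iff_ne_zero.mpr (Nat.mul_ne_zero (by omega) (by omega))),
      hrat x.1 x.2 hx1 hx2, hrat y.1 y.2 hy1 hy2, prod_localRatio_mul c' χ _ hcop,
      lam1_mul_of_coprime c' χ hcop1]
    push_cast
    rw [Complex.natCast_mul_natCast_cpow, map_mul]
    ring

/-- **(15.19) for the printed coefficients `b` — DISCHARGED** (`𝒮₁ⱼ = 𝓜₁(1,1;1−βⱼ)Σₙ b(n)ϖ₁ⱼ(n)/n`;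
the tree edge `eq15_19_of_ne_zero` fed with `calM1_one_one_betaJ_ne_zero`).
[cite: Zhang2022LandauSiegel, §15 (15.19) p.85] -/
theorem eq15_19_lit_holds (c' : ℝ) : Eq15_19 c' bLit :=
  eq15_19_of_ne_zero c' bLit (calM1_one_one_betaJ_ne_zero c')

/-- **(15.19) for the χ-absorbed coefficients `χ·b` — DISCHARGED.**
[cite: Zhang2022LandauSiegel, §15 (15.19) p.85] -/
theorem eq15_19_chi_holds (c' : ℝ) : Eq15_19 c' bChi :=
  eq15_19_of_ne_zero c' bChi (calM1_one_one_betaJ_ne_zero c')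

/-- **(15.20) for the printed coefficients `b` — DISCHARGED** (the factorisation `n = n₁n₂`,
`n₁ ∈ 𝒩(𝒬)`, `(n₂,𝒬) = 1`; tree edge `eq15_20_lit_of_varpiMult`).
[cite: Zhang2022LandauSiegel, §15 (15.20) p.86] -/
theorem eq15_20_lit_holds (c' : ℝ) : Eq15_20 c' bLit :=
  eq15_20_lit_of_varpiMult c' (inline15_varpiMult_holds c')

/-- **(15.20) for the χ-absorbed coefficients `χ·b` — DISCHARGED.**
[cite: Zhang2022LandauSiegel, §15 (15.20) p.86] -/
theorem eq15_20_chi_holds (c' : ℝ) : Eq15_20 c' bChi :=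
  eq15_20_chi_of_varpiMult c' (inline15_varpiMult_holds c')

/-! ## §4. §15.u040 and (15.21), discharged -/

/-- If `(n,𝒬) = 1` (`𝒬 = ∏_{q<D⁴} q`), every prime factor of `n` is at least `D⁴`.
[cite: Zhang2022LandauSiegel, §15 p.86] -/
theorem pow_four_le_of_mem_primeFactors_of_coprime_frakq {D n q : ℕ}
    (hn : Nat.Coprime n (Skeleton.frakq D)) (hq : q ∈ n.primeFactors) : D ^ 4 ≤ q := by
  have hqP := Nat.prime_of_mem_primeFactors hq
  have hqn := Nat.dvd_of_mem_primeFactors hq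
  by_contra hlt
  have hqQ : q ∣ Skeleton.frakq D := (prime_dvd_frakq_iff hqP).mpr (not_le.mp hlt)
  have h1 : q ∣ Nat.gcd n (Skeleton.frakq D) := Nat.dvd_gcd hqn hqQ
  rw [Nat.Coprime.gcd_eq_one hn] at h1
  exact hqP.one_lt.ne' (Nat.dvd_one.mp h1)

/-- A natural number all of whose prime factors are `≥ z > 1` has at most `log n/log z` of them
(`z^{ω(n)} ≤ ∏_{q∣n} q ≤ n`). [folklore] -/
private theorem card_primeFactors_le_log_div {n : ℕ} (hn : n ≠ 0) {z : ℝ} (hz : 1 < z)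
    (hr : ∀ p ∈ n.primeFactors, z ≤ (p : ℝ)) :
    (n.primeFactors.card : ℝ) ≤ Real.log n / Real.log z := by
  have hz0 : 0 < z := by linarith
  have h1 : z ^ n.primeFactors.card ≤ ∏ p ∈ n.primeFactors, (p : ℝ) := by
    rw [← Finset.prod_const]
    exact Finset.prod_le_prod (fun _ _ => hz0.le) fun p hp => hr p hp
  have h2 : ∏ p ∈ n.primeFactors, (p : ℝ) ≤ n := by
    have h3 : ∏ p ∈ n.primeFactors, p ≤ n :=
      Nat.le_of_dvd (Nat.pos_of_ne_zero hn) (Nat.prod_primeFactors_dvd n)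
    have h4 : ((∏ p ∈ n.primeFactors, p : ℕ) : ℝ) ≤ n := by exact_mod_cast h3
    rwa [Nat.cast_prod] at h4
  have h5 := Real.log_le_log (by positivity) (h1.trans h2)
  rw [Real.log_pow] at h5
  rw [le_div_iff₀ (Real.log_pos hz)]
  exact h5

/-- `λ₁(d) = ∏_{q∣d} λ₁(q)` (the definition (15.10) of `λ₁(n,s)` is a product over the prime factors;
`λ₁(q,s)` at a prime `q` is the single factor). [cite: Zhang2022LandauSiegel, §15 (15.10) p.82] -/
theorem lam1_eq_prod_primeFactors (c' : ℝ) {D : ℕ} (χ : DirichletCharacter ℂ D) (d : ℕ) (s : ℂ) :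
    lam1 c' χ d s = ∏ q ∈ d.primeFactors, lam1 c' χ q s := by
  unfold lam1
  refine Finset.prod_congr rfl fun q hq => ?_
  rw [(Nat.prime_of_mem_primeFactors hq).primeFactors, Finset.prod_singleton]

/-- One local factor of §15.u040: if `‖F − 1‖ ≤ a`, `‖F₀ − 1‖ ≤ b ≤ 1/2` and `‖μ − 1‖ ≤ m`, then
`‖μ·F/F₀ − 1‖ ≤ 2(a+b)(1+m) + m`. [folklore] -/
private theorem norm_mul_div_sub_one_le {F F₀ μ : ℂ} {a b m : ℝ} (hF : ‖F - 1‖ ≤ a) (hF₀ : ‖F₀ - 1‖ ≤ b)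
    (hb : b ≤ 1 / 2) (hμ : ‖μ - 1‖ ≤ m) :
    ‖μ * (F / F₀) - 1‖ ≤ 2 * (a + b) * (1 + m) + m := by
  have ha0 : 0 ≤ a := (norm_nonneg _).trans hF
  have hb0 : 0 ≤ b := (norm_nonneg _).trans hF₀
  have hm0 : 0 ≤ m := (norm_nonneg _).trans hμ
  have hF₀n : 1 / 2 ≤ ‖F₀‖ := by
    have := norm_sub_norm_le (1 : ℂ) F₀
    rw [norm_one, norm_sub_rev] at this
    linarith
  have hF₀0 : F₀ ≠ 0 := by
    intro h; rw [h, norm_zero] at hF₀n; linarith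
  have hr : ‖F / F₀ - 1‖ ≤ 2 * (a + b) := by
    rw [div_sub_one hF₀0, norm_div]
    have hnum : ‖F - F₀‖ ≤ a + b := by
      calc ‖F - F₀‖ = ‖(F - 1) - (F₀ - 1)‖ := by ring_nf
        _ ≤ ‖F - 1‖ + ‖F₀ - 1‖ := norm_sub_le _ _
        _ ≤ a + b := add_le_add hF hF₀
    rw [div_le_iff₀ (by linarith)]
    nlinarith
  have hrn : ‖F / F₀‖ ≤ 1 + 2 * (a + b) := by
    have := norm_add_le (F / F₀ - 1) 1
    rw [sub_add_cancel, norm_one] at this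
    linarith
  calc ‖μ * (F / F₀) - 1‖ = ‖(μ - 1) * (F / F₀) + (F / F₀ - 1)‖ := by ring_nf
    _ ≤ ‖(μ - 1) * (F / F₀)‖ + ‖F / F₀ - 1‖ := norm_add_le _ _
    _ = ‖μ - 1‖ * ‖F / F₀‖ + ‖F / F₀ - 1‖ := by rw [norm_mul]
    _ ≤ m * (1 + 2 * (a + b)) + 2 * (a + b) := by
        gcongr
    _ = 2 * (a + b) * (1 + m) + m := by ring

/-- `‖∏_{i∈S} g i − 1‖ ≤ exp(Σ_{i∈S} ‖g i − 1‖) − 1` (Mathlib `Finset.norm_prod_one_add_sub_one_le`).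
[folklore] -/
private theorem norm_prod_sub_one_le' {ι : Type*} (S : Finset ι) (g : ι → ℂ) :
    ‖∏ i ∈ S, g i - 1‖ ≤ Real.exp (∑ i ∈ S, ‖g i - 1‖) - 1 := by
  have h := S.norm_prod_one_add_sub_one_le (fun i => g i - 1)
  simpa only [add_sub_cancel] using h

/-- Real-power bookkeeping for the primes `q ≥ D⁴` of §15.u040 (`D ≥ 2`, `Q = q`): `Q ≥ 16`,
`Q^{−19/10} ≤ Q^{−9/10}`, `8/Q ≤ 8Q^{−9/10}`, `Q^{−9/10} ≤ 1` and `Q^{−9/10} ≤ D⁻³`. [folklore] -/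
private theorem rpow_facts {D q : ℕ} (hD : 2 ≤ D) (hq : D ^ 4 ≤ q) :
    (16 : ℝ) ≤ q ∧ (q : ℝ) ^ (-(19 / 10 : ℝ)) ≤ (q : ℝ) ^ (-(9 / 10 : ℝ)) ∧
      8 / (q : ℝ) ≤ 8 * (q : ℝ) ^ (-(9 / 10 : ℝ)) ∧ (q : ℝ) ^ (-(9 / 10 : ℝ)) ≤ 1 ∧
        (q : ℝ) ^ (-(9 / 10 : ℝ)) ≤ (D : ℝ) ^ (-(3 : ℝ)) := by
  have hD16 : 16 ≤ D ^ 4 := by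
    calc 16 = 2 ^ 4 := by norm_num
      _ ≤ D ^ 4 := Nat.pow_le_pow_left hD 4
  have hq16 : (16 : ℝ) ≤ q := by exact_mod_cast hD16.trans hq
  have hq1 : (1 : ℝ) ≤ q := by linarith
  have hq0 : (0 : ℝ) < q := by linarith
  have hD1 : (1 : ℝ) ≤ D := by exact_mod_cast (show 1 ≤ D by omega)
  have hD0 : (0 : ℝ) < D := by linarith
  refine ⟨hq16, Real.rpow_le_rpow_of_exponent_le hq1 (by norm_num), ?_, ?_, ?_⟩
  · have : 1 / (q : ℝ) ≤ (q : ℝ) ^ (-(9 / 10 : ℝ)) := by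
      rw [one_div, ← Real.rpow_neg_one]
      exact Real.rpow_le_rpow_of_exponent_le hq1 (by norm_num)
    calc 8 / (q : ℝ) = 8 * (1 / q) := by ring
      _ ≤ 8 * (q : ℝ) ^ (-(9 / 10 : ℝ)) := by gcongr
  · calc (q : ℝ) ^ (-(9 / 10 : ℝ)) ≤ (q : ℝ) ^ (0 : ℝ) :=
          Real.rpow_le_rpow_of_exponent_le hq1 (by norm_num)
      _ = 1 := Real.rpow_zero _
  · have hDq : ((D : ℝ) ^ 4) ≤ q := by exact_mod_cast hq
    calc (q : ℝ) ^ (-(9 / 10 : ℝ)) ≤ ((D : ℝ) ^ 4) ^ (-(9 / 10 : ℝ)) :=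
          Real.rpow_le_rpow_of_nonpos (by positivity) hDq (by norm_num)
      _ = (D : ℝ) ^ (-(18 / 5 : ℝ)) := by
          rw [← Real.rpow_natCast, ← Real.rpow_mul hD0.le]; norm_num
      _ ≤ (D : ℝ) ^ (-(3 : ℝ)) := Real.rpow_le_rpow_of_exponent_le hD1 (by norm_num)

/-- `𝓛⁸ ≤ 8!·D` (`x⁸/8! ≤ eˣ` at `x = log D`). [folklore] -/
private theorem ell_pow_eight_le {D : ℕ} (hD : 2 ≤ D) : ell D ^ 8 ≤ 40320 * (D : ℝ) := by
  have hD0 : (0 : ℝ) < D := by exact_mod_cast (show 0 < D by omega)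
  have hℓ0 : 0 ≤ ell D := Real.log_nonneg (by exact_mod_cast (show 1 ≤ D by omega))
  have h := Real.pow_div_factorial_le_exp (ell D) hℓ0 8
  rw [show ((Nat.factorial 8 : ℕ) : ℝ) = 40320 by norm_num [Nat.factorial], ell,
    Real.exp_log hD0, div_le_iff₀ (by norm_num : (0:ℝ) < 40320)] at h
  rw [ell]; linarith

/-- **§15.u040 DISCHARGED** (p.86, tex L4258): for all large `D`, under (A), for `1 ≤ j ≤ 3`,
`n = dl < PT⁻³` with `(n,𝒬) = 1`: `‖λ₁(d)𝓜₁(d,l;1−βⱼ)/𝓜₁(1,1;1−βⱼ) − 1‖ ≤ C·D⁻²`. Proof: by the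
restricted (15.18) (`calM1_div_eq_prod_factor_div_eventually`, `𝓜₁(1,1;1−βⱼ) ≠ 0` by
`norm_calM1_one_one_betaJ_ge`) and `λ₁(d) = ∏_{q∣d}λ₁(q)`, the quantity is a product over the primes
`q ∣ n` — all `≥ D⁴` — of factors `λ̂_q·F_q(d,l)/F_q(1,1)` with `F_q(d,l) = 1 + O(q^{−9/10})` (§15.u033,
`step15_u033_holds`), `F_q(1,1) = 1 + O(q^{−19/10})` (§15.u032, `step15_u032_holds`), `λ̂_q ∈ {λ₁(q), 1}`,
`λ₁(q) = 1 + O(1/q)` (`norm_lam1_prime_one_sub_one_le`); there are `≤ log n/log D⁴ ≤ 𝓛⁸/4` such primes,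
so the product is `1 + O(𝓛⁸D^{−18/5}) = 1 + O(D⁻²)`. [cite: Zhang2022LandauSiegel, §15 p.86] -/
theorem step15_u040_holds (c' : ℝ) : Step15_u040 c' := by
  classical
  obtain ⟨C₂, h32⟩ := step15_u032_holds c'
  obtain ⟨C₃, h33⟩ := step15_u033_holds c'
  set C₂' : ℝ := max C₂ 0 with hC₂'
  set C₃' : ℝ := max C₃ 0 with hC₃'
  set K : ℝ := 18 * (C₂' + C₃') + 8 with hK
  have hC₂'0 : 0 ≤ C₂' := le_max_right _ _
  have hC₃'0 : 0 ≤ C₃' := le_max_right _ _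
  have hK0 : 0 ≤ K := by rw [hK]; positivity
  -- threshold: `D ≥ N` with `N ≥ 2`, `N ≥ 2C₂'`, `N ≥ 10080·K`
  set N : ℕ := max 2 (max ⌈2 * C₂'⌉₊ ⌈10080 * K⌉₊) with hN
  have hT : ForAllLarge fun D _ _ => N ≤ D := ForAllLarge.of_le N fun _ _ _ hD _ _ => hD
  refine ⟨2, by norm_num, 20160 * K, ?_⟩
  refine ((((h32.and h33).and (calM1_div_eq_prod_factor_div_eventually c')).and
    (norm_calM1_one_one_betaJ_ge c')).and hT).mono fun D _ χ _ _ h hA j hj n d l hn hdl hnP hcop => ?_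
  obtain ⟨⟨⟨⟨g32, g33⟩, grat⟩, gne⟩, hND⟩ := h
  have hD2 : 2 ≤ D := (le_max_left _ _).trans hND
  have hDC₂ : 2 * C₂' ≤ D := le_trans (Nat.le_ceil _)
    (by exact_mod_cast ((le_max_left _ _).trans ((le_max_right _ _).trans hND)))
  have hDK : 10080 * K ≤ D := le_trans (Nat.le_ceil _)
    (by exact_mod_cast ((le_max_right _ _).trans ((le_max_right _ _).trans hND)))
  have hD0 : (0 : ℝ) < D := by exact_mod_cast (show 0 < D by omega)
  have hD1 : (1 : ℝ) ≤ D := by exact_mod_cast (show 1 ≤ D by omega)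
  -- the point `s = 1 − βⱼ`
  obtain ⟨-, hsre1, hnorm⟩ := gne hA j hj
  set s : ℂ := 1 - Skeleton.betaJ c' D j with hs
  have hsre : 9 / 10 < s.re := by rw [hsre1]; norm_num
  have hM0 : calM1 c' χ 1 1 s ≠ 0 := by
    intro h0; rw [h0, norm_zero] at hnorm; linarith
  -- `d, l ≥ 1`, the prime factors of `n`
  have hn0 : n ≠ 0 := by omega
  have hd : 1 ≤ d := Nat.pos_of_ne_zero fun h0 => hn0 (by rw [← hdl, h0, zero_mul])
  have hl : 1 ≤ l := Nat.pos_of_ne_zero fun h0 => hn0 (by rw [← hdl, h0, mul_zero])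
  set S : Finset ℕ := n.primeFactors with hSdef
  have hq4 : ∀ q ∈ S, D ^ 4 ≤ q := fun q hq =>
    pow_four_le_of_mem_primeFactors_of_coprime_frakq hcop hq
  -- the quantity as a product over `S`
  set μ : ℕ → ℂ := fun q => if q ∣ d then lam1 c' χ q 1 else 1 with hμ
  have hlam : lam1 c' χ d 1 = ∏ q ∈ S, μ q := by
    rw [lam1_eq_prod_primeFactors, hμ, Finset.prod_ite, Finset.prod_const_one, mul_one]
    refine Finset.prod_congr ?_ fun q _ => rfl
    ext q
    rw [Finset.mem_filter, hSdef, ← hdl, Nat.mem_primeFactors, Nat.mem_primeFactors]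
    constructor
    · rintro ⟨hqP, hqd, hd0⟩
      exact ⟨⟨hqP, dvd_mul_of_dvd_left hqd l, Nat.mul_ne_zero hd0 (by omega)⟩, hqd⟩
    · rintro ⟨⟨hqP, -, -⟩, hqd⟩
      exact ⟨hqP, hqd, by omega⟩
  have hprod : lam1 c' χ d 1 * calM1 c' χ d l s / calM1 c' χ 1 1 s =
      ∏ q ∈ S, μ q * (calM1Factor c' χ q d l s / calM1Factor c' χ q 1 1 s) := by
    rw [mul_div_assoc, grat hA d l hd hl s hsre hM0, hlam, hSdef, ← hdl, ← Finset.prod_mul_distrib]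
  rw [hprod]
  -- the local estimates
  have hloc : ∀ q ∈ S, ‖μ q * (calM1Factor c' χ q d l s / calM1Factor c' χ q 1 1 s) - 1‖ ≤
      K * (D : ℝ) ^ (-(3 : ℝ)) := by
    intro q hq
    have hqP : q.Prime := Nat.prime_of_mem_primeFactors hq
    have hqn : q ∣ n := Nat.dvd_of_mem_primeFactors hq
    obtain ⟨hq16, h19, h8, hle1, hqD⟩ := rpow_facts hD2 (hq4 q hq)
    have hq0 : (0 : ℝ) < q := by linarith
    have hrp0 : 0 ≤ (q : ℝ) ^ (-(9 / 10 : ℝ)) := Real.rpow_nonneg hq0.le _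
    -- `F_q(d,l) = 1 + O(q^{-9/10})` (u033: `q ∣ dl`)
    have hncop : ¬ Nat.Coprime q (d * l) := by
      rw [hdl, Nat.Prime.coprime_iff_not_dvd hqP, not_not]; exact hqn
    have eF : ‖calM1Factor c' χ q d l s - 1‖ ≤ C₃' * (q : ℝ) ^ (-(9 / 10 : ℝ)) :=
      (g33 hA q d l hqP hd hl hncop s hsre).trans
        (mul_le_mul_of_nonneg_right (le_max_left _ _) hrp0)
    -- `F_q(1,1) = 1 + O(q^{-19/10})` (u032: `(q,1) = 1`)
    have eF₀ : ‖calM1Factor c' χ q 1 1 s - 1‖ ≤ C₂' * (q : ℝ) ^ (-(9 / 10 : ℝ)) := by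
      have h := g32 hA q 1 1 hqP le_rfl le_rfl (Nat.coprime_one_right q) s hsre
      exact h.trans ((mul_le_mul_of_nonneg_right (le_max_left _ _)
        (Real.rpow_nonneg hq0.le _)).trans (mul_le_mul_of_nonneg_left h19 hC₂'0))
    have hb : C₂' * (q : ℝ) ^ (-(9 / 10 : ℝ)) ≤ 1 / 2 := by
      have h3 : (D : ℝ) ^ (-(3 : ℝ)) ≤ (D : ℝ) ^ (-(1 : ℝ)) :=
        Real.rpow_le_rpow_of_exponent_le hD1 (by norm_num)
      rw [Real.rpow_neg_one] at h3
      calc C₂' * (q : ℝ) ^ (-(9 / 10 : ℝ)) ≤ C₂' * (D : ℝ)⁻¹ :=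
            mul_le_mul_of_nonneg_left (hqD.trans h3) hC₂'0
        _ = C₂' / D := by ring
        _ ≤ 1 / 2 := by rw [div_le_iff₀ hD0]; linarith
    -- `μ_q = 1 + O(1/q)`
    have eμ : ‖μ q - 1‖ ≤ 8 * (q : ℝ) ^ (-(9 / 10 : ℝ)) := by
      have h1 : ‖μ q - 1‖ ≤ 8 / q := by
        simp only [hμ]
        split_ifs
        · exact norm_lam1_prime_one_sub_one_le c' χ hqP
        · rw [sub_self, norm_zero]; positivity
      exact h1.trans h8
    have hloc1 := norm_mul_div_sub_one_le eF eF₀ hb eμ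
    refine hloc1.trans ?_
    -- `2(C₃'+C₂')x(1+8x) + 8x ≤ K·x ≤ K·D⁻³` with `x = q^{-9/10} ≤ 1`
    have hx1 : 8 * (q : ℝ) ^ (-(9 / 10 : ℝ)) ≤ 8 := by nlinarith
    calc 2 * (C₃' * (q : ℝ) ^ (-(9 / 10 : ℝ)) + C₂' * (q : ℝ) ^ (-(9 / 10 : ℝ))) *
          (1 + 8 * (q : ℝ) ^ (-(9 / 10 : ℝ))) + 8 * (q : ℝ) ^ (-(9 / 10 : ℝ))
        ≤ 2 * (C₃' * (q : ℝ) ^ (-(9 / 10 : ℝ)) + C₂' * (q : ℝ) ^ (-(9 / 10 : ℝ))) * (1 + 8) +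
          8 * (q : ℝ) ^ (-(9 / 10 : ℝ)) := by
          gcongr
      _ = K * (q : ℝ) ^ (-(9 / 10 : ℝ)) := by rw [hK]; ring
      _ ≤ K * (D : ℝ) ^ (-(3 : ℝ)) := mul_le_mul_of_nonneg_left hqD hK0
  -- the number of primes
  have hcard : (S.card : ℝ) ≤ ell D ^ 8 / 4 := by
    have hz : (1 : ℝ) < (D : ℝ) ^ 4 :=
      one_lt_pow₀ (by exact_mod_cast (show 1 < D by omega)) (by norm_num)
    have h1 := card_primeFactors_le_log_div hn0 hz (fun p hp => by exact_mod_cast hq4 p hp)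
    have hlogn : Real.log n ≤ ell D ^ 9 := by
      have hn1 : (0 : ℝ) < n := by exact_mod_cast Nat.pos_of_ne_zero hn0
      have hℓnn : 0 ≤ ell D := Real.log_nonneg (by exact_mod_cast (show 1 ≤ D by omega))
      have hT1 : 1 ≤ Skeleton.bigT D := by
        rw [Skeleton.bigT]; exact Real.one_le_exp (Real.rpow_nonneg hℓnn _)
      have hT0 : 0 < Skeleton.bigT D ^ 3 := by positivity
      have hnP' : (n : ℝ) ≤ Skeleton.bigP D := by
        refine hnP.le.trans ?_
        rw [div_le_iff₀ hT0]
        have hP0 : 0 ≤ Skeleton.bigP D := by rw [Skeleton.bigP]; positivity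
        nlinarith [one_le_pow₀ (n := 3) hT1]
      calc Real.log n ≤ Real.log (Skeleton.bigP D) := Real.log_le_log hn1 hnP'
        _ = ell D ^ 9 := by rw [Skeleton.bigP, Real.log_exp]
    have hlog4 : Real.log ((D : ℝ) ^ 4) = 4 * ell D := by rw [Real.log_pow, ell]; push_cast; ring
    rw [hlog4] at h1
    have hℓ0 : 0 < ell D := Real.log_pos (by exact_mod_cast (show 1 < D by omega))
    calc (S.card : ℝ) ≤ Real.log n / (4 * ell D) := h1
      _ ≤ ell D ^ 9 / (4 * ell D) := by gcongr
      _ = ell D ^ 8 / 4 := by field_simp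
  -- the sum of the local errors
  have hsum : ∑ q ∈ S, ‖μ q * (calM1Factor c' χ q d l s / calM1Factor c' χ q 1 1 s) - 1‖ ≤
      10080 * K * (D : ℝ) ^ (-(2 : ℝ)) := by
    calc ∑ q ∈ S, ‖μ q * (calM1Factor c' χ q d l s / calM1Factor c' χ q 1 1 s) - 1‖
        ≤ ∑ q ∈ S, K * (D : ℝ) ^ (-(3 : ℝ)) := Finset.sum_le_sum hloc
      _ = S.card * (K * (D : ℝ) ^ (-(3 : ℝ))) := by rw [Finset.sum_const, nsmul_eq_mul]
      _ ≤ ell D ^ 8 / 4 * (K * (D : ℝ) ^ (-(3 : ℝ))) := by gcongr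
      _ ≤ 40320 * (D : ℝ) / 4 * (K * (D : ℝ) ^ (-(3 : ℝ))) := by
          gcongr; exact ell_pow_eight_le hD2
      _ = 10080 * K * ((D : ℝ) ^ (1 : ℝ) * (D : ℝ) ^ (-(3 : ℝ))) := by rw [Real.rpow_one]; ring
      _ = 10080 * K * (D : ℝ) ^ (-(2 : ℝ)) := by rw [← Real.rpow_add hD0]; norm_num
  have hsum1 : 10080 * K * (D : ℝ) ^ (-(2 : ℝ)) ≤ 1 := by
    have h2 : (D : ℝ) ^ (-(2 : ℝ)) ≤ (D : ℝ) ^ (-(1 : ℝ)) :=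
      Real.rpow_le_rpow_of_exponent_le hD1 (by norm_num)
    rw [Real.rpow_neg_one] at h2
    calc 10080 * K * (D : ℝ) ^ (-(2 : ℝ)) ≤ 10080 * K * (D : ℝ)⁻¹ := by gcongr
      _ = 10080 * K / D := by ring
      _ ≤ 1 := by rw [div_le_one hD0]; exact hDK
  -- conclude
  have hS0 : 0 ≤ ∑ q ∈ S, ‖μ q * (calM1Factor c' χ q d l s / calM1Factor c' χ q 1 1 s) - 1‖ :=
    Finset.sum_nonneg fun q _ => norm_nonneg _
  refine (norm_prod_sub_one_le' S _).trans ?_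
  have hexp := Real.abs_exp_sub_one_le (x := ∑ q ∈ S,
    ‖μ q * (calM1Factor c' χ q d l s / calM1Factor c' χ q 1 1 s) - 1‖)
    (by rw [abs_of_nonneg hS0]; exact hsum.trans hsum1)
  rw [abs_of_nonneg hS0] at hexp
  have := le_abs_self (Real.exp (∑ q ∈ S,
    ‖μ q * (calM1Factor c' χ q d l s / calM1Factor c' χ q 1 1 s) - 1‖) - 1)
  linarith

variable (c' : ℝ) in
/-- `Step15_u040` — `_holds` alias of `step15_u040_holds` above under the fact's exact name, stated under the
prover's own binders as section variables (appended 2026-08-28, D-0026 bookkeeping: the proof term is the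
existing theorem of this file; no statement, definition or attribute is edited; no new named fact; the
ledger's debt table listed the fact unproved). [cite: Zhang2022LandauSiegel, §15 p.86] -/
theorem _root_.Literature.NumberTheory.LFunctions.Zhang2022.Typed.Section15B.Step15_u040_holds :
    _root_.Literature.NumberTheory.LFunctions.Zhang2022.Typed.Section15B.Step15_u040 c' :=
  _root_.Literature.NumberTheory.LFunctions.Zhang2022.Typed.Section15B.step15_u040_holds (c' := c')

/-- **(15.21) DISCHARGED** (p.86, tex L4262; the tree edge `eq15_21_of_step15_u040` fed with
`step15_u040_holds`): for all large `D`, under (A), `1 ≤ j ≤ 3`, `n < PT⁻³`, `(n,𝒬) = 1`: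
`ϖ₁ⱼ(n) = χ(n)ϱ*ⱼ(n) + O(τ₂(n)D⁻ᶜ)`. [cite: Zhang2022LandauSiegel, §15 (15.21) p.86] -/
theorem eq15_21_holds (c' : ℝ) : Eq15_21 c' := eq15_21_of_step15_u040 c' (step15_u040_holds c')

variable (c' : ℝ) in
/-- `Eq15_21` — `_holds` alias of `eq15_21_holds` above under the fact's exact name, stated under the
prover's own binders as section variables (appended 2026-08-28, D-0026 bookkeeping: the proof term is the
existing theorem of this file; no statement, definition or attribute is edited; no new named fact; the
ledger's debt table listed the fact unproved). [cite: Zhang2022LandauSiegel, §15 (15.21) p.86] -/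
theorem _root_.Literature.NumberTheory.LFunctions.Zhang2022.Typed.Section15B.Eq15_21_holds :
    _root_.Literature.NumberTheory.LFunctions.Zhang2022.Typed.Section15B.Eq15_21 c' :=
  _root_.Literature.NumberTheory.LFunctions.Zhang2022.Typed.Section15B.eq15_21_holds (c' := c')

end Literature.NumberTheory.LFunctions.Zhang2022.Typed.Section15B
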